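import Summits.BirchSwinnertonDyer.BirchSwinnertonDyer.Theorems.ByReductionTypeAtTwoMultTowerSplitExactOddNormGroup
import Summits.BirchSwinnertonDyer.BirchSwinnertonDyer.Theorems.ByReductionTypeAtTwoMultTowerSplitExactOddDepth
import HarnessLib

/-!
# Route `ByReductionTypeAtTwo`, crux `MultUpperHalfAtTwo` (item stmt-BirchSwinnertonDyer-19922), TOWER road, SPLIT rows:
# the EXACT order of the local tower kernel at a split multiplicative prime, part 9 (ODD `p`) — the NON-NORM lemmas:
# `q^{p^j a} ∉ N(F_mˣ)` for `p ∤ a`, `d + j ≤ m`, and the relative form `∏_{i<p^R} g^i f ≠ q^{p^j a}`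

HONEST FRAMING (cell `bsd-2adic`, run/shared/lean/pub/bsd-2adic/, seat `bsd-2adic-tower-1` GEN 27, HUMAN RULINGS
D-0036 / D-0054 / D-0074): TOOL theorems only (no definition, no named fact, no `sorry`); closes nothing by itself;
nothing booked; BSD is not proved by any of this. Odd-`p` analogue of seat bsd-2adic-mult GEN 13's
`…MultTowerSplitOrderNonNorm.lean` (BRICK S2), for the UPPER bound of the `∀ p` named fact
`hSP = Greenberg1999.sec3_natCard_localTowerKerPrimary_splitMultiplicative_rat`:

* `prod_smul_prime_pow_add` — `N_{R+t}(x) = N_R(x)^{p^t}` when `g^{p^R} x = x` (orbit products several layers up);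
* `norm_ne_pow_of_depth_odd` — **no element of `F_m` has norm `q^{p^j a}`** (`e q = p^k u`, `u` of depth `d`:
  `‖1 − u^{p−1}‖ = p^{−d}`, `p ∤ a`, `d + j ≤ m`): norms from `F_m` have unit part `w` with `w^{p−1} ≡ 1 (mod p^{m+1})` (part 7),
  while `(u^{p^j a})^{p−1} ≢ 1 (mod p^{m+1})` (part 8);
* `prod_smul_ne_pow_of_depth_odd` — **`∏_{i<p^R} g^i f ≠ q^{p^j a}` for `f ∈ F_{n+R}`, `d + j ≤ R`**: the `g₀^i g^{i'}`
  (`i < p^n`, `i' < p^R`) represent `Γ/H_{n+R}`, so `N_{F_{n+R}/ℚ_v}(f) = ∏_i g₀^i (∏_{i'} g^{i'} f)` would be `q^{p^{n+j} a}`,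
  contradicting the absolute lemma at level `n + R ≥ d + (n + j)`.

References: J. Neukirch, *Algebraic Number Theory*, Ch. V §1 (1.1); R. Greenberg, LNM 1716 §3 (PDF pp. 92–93);
cell memo NOTE-HNS2-KERNEL-GEN27.md (Stage D plan).
-/

set_option autoImplicit false
-- the Theorems namespace of this sub repeats the summit name by design (D-0017 nested layout: Summit.<S>.<Sub>)
set_option linter.dupNamespace false

noncomputable section

open scoped Classical IntermediateField

namespace Summit.BirchSwinnertonDyer.BirchSwinnertonDyer.Theorems.MultTowerSplitExact

open NumberField IsDedekindDomain Field PadicInt Literature.NumberTheory.EllipticCurves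
  Literature.NumberTheory.GaloisRepresentations

/-! ### Orbit products several layers up (any `p`) -/

section OrbitProducts

variable {K : Type*} [Field K]

/-- **`N_{R+t}(x) = N_R(x)^{p^t}` when `g^{p^R} x = x`** (`N_S(x) = ∏_{i<p^S} g^i x`): the range `[0, p^{R+t})` splits into
`p^t` blocks of length `p^R` (`MultTowerSP1.prod_smul_range_mul_eq_pow`). The `p`-general form of GEN 13's
`prod_smul_two_pow_add`. [folklore] -/
theorem prod_smul_prime_pow_add (p : ℕ) (g : absoluteGaloisGroup K) (R : ℕ) {x : AlgebraicClosure K}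
    (hx : (g ^ p ^ R) • x = x) (t : ℕ) :
    (∏ i ∈ Finset.range (p ^ (R + t)), (g ^ i) • x) = (∏ i ∈ Finset.range (p ^ R), (g ^ i) • x) ^ p ^ t := by
  rw [pow_add, MultTowerSP1.prod_smul_range_mul_eq_pow g (p ^ R) hx (p ^ t)]

end OrbitProducts

variable {p : ℕ} [hp : Fact p.Prime] {κ : ZpExtension ℚ p}

/-! ### The absolute non-norm lemma at depth `d` (odd `p`) -/

/-- **The tower non-norm lemma at depth `d`, absolute form (odd `p`).** For `v ∋ p`, a ring isomorphism `e : ℚ_v ≃ ℚ_p`,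
`q ∈ ℚ_v` with `e q = p^k · u`, `u ∈ ℤ_pˣ` of depth `d` (`‖1 − u^{p−1}‖ = p^{−d}`, i.e. `ord_p log_p q = d`, part 8), `p ∤ a`
and `d + j ≤ m`: **no element of the local layer `F_m` has norm `q^{p^j a}`** — norms from `F_m` have unit part `w` with
`w^{p−1} ≡ 1 (mod p^{m+1})` (part 7 `mem_range_norm_fixedField_layer_iff_odd`), while `(u^{p^j a})^{p−1} ≢ 1 (mod p^{m+1})`
(part 8 `toZModPow_pow_pow_ne_one_of_depth`). [cite: NeukirchANT1999, Ch. V §1 Thm. (1.1)]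
[cite: GreenbergLNM1716, §3, between Prop. 3.6 and Prop. 3.7 (PDF pp. 92–93)] -/
theorem norm_ne_pow_of_depth_odd (hp2 : p ≠ 2) (hκ : κ.IsCyclotomic) (v : HeightOneSpectrum (𝓞 ℚ))
    (hv : ((p : ℕ) : 𝓞 ℚ) ∈ v.asIdeal) (e : v.adicCompletion ℚ ≃+* ℚ_[p]) {q : v.adicCompletion ℚ} {k : ℕ}
    {u : ℤ_[p]ˣ} (hq : e q = (p : ℚ_[p]) ^ k * ((u : ℤ_[p]) : ℚ_[p])) {d : ℕ}
    (hd : ‖1 - ((u : ℤ_[p]) : ℚ_[p]) ^ (p - 1)‖ = (p : ℝ) ^ (-(d : ℤ))) {a : ℕ} (ha : ¬ p ∣ a) {j m : ℕ}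
    (hm : d + j ≤ m)
    (f : IntermediateField.fixedField (localSubgroup (κ.layerSubgroup m) (v.adicCompletion ℚ))) :
    Algebra.norm (v.adicCompletion ℚ) f ≠ q ^ (p ^ j * a) := by
  intro hf
  have hp0 : (p : ℚ_[p]) ≠ 0 := by exact_mod_cast hp.out.ne_zero
  have hq0 : q ≠ 0 := by
    intro h0
    rw [h0, map_zero, eq_comm, mul_eq_zero] at hq
    rcases hq with h | h
    · exact absurd h (pow_ne_zero _ hp0)
    · exact u.ne_zero (PadicInt.coe_eq_zero.mp h)
  haveI := MultTowerNS2.finiteDimensional_fixedField_localSubgroup_layerSubgroup (κ := κ) v m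
  have hmem : Units.mk0 (q ^ (p ^ j * a)) (pow_ne_zero _ hq0) ∈
      (Units.map (Algebra.norm (v.adicCompletion ℚ) :
        IntermediateField.fixedField (localSubgroup (κ.layerSubgroup m) (v.adicCompletion ℚ)) →*
          v.adicCompletion ℚ)).range := by
    have hf0 : f ≠ 0 := by
      rintro rfl
      rw [Algebra.norm_zero] at hf
      exact pow_ne_zero _ hq0 hf.symm
    exact ⟨Units.mk0 f hf0, Units.ext (by simp [hf])⟩
  rw [mem_range_norm_fixedField_layer_iff_odd hp2 hκ v hv m e] at hmem
  obtain ⟨j', w', hw', hjw⟩ := hmem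
  have hlhs : e (q ^ (p ^ j * a)) = (p : ℚ_[p]) ^ (((k * (p ^ j * a) : ℕ)) : ℤ) *
      (((u ^ (p ^ j * a) : ℤ_[p]ˣ) : ℤ_[p]) : ℚ_[p]) := by
    rw [map_pow, hq, mul_pow, ← pow_mul, zpow_natCast, Units.val_pow_eq_pow_val, PadicInt.coe_pow]
  rw [Units.val_mk0, hlhs] at hjw
  obtain ⟨-, hwU⟩ := prime_zpow_mul_units_inj hjw
  -- `w' = u ^ (p^j a)` has `(w')^{p-1} ≢ 1 (mod p^{m+1})`
  rw [← hwU, Units.val_pow_eq_pow_val] at hw'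
  exact toZModPow_pow_pow_ne_one_of_depth hp2 hd ha j hm hw'

/-! ### The relative non-norm lemma in orbit-product form (odd `p`) -/

/-- **`∏_{i<p^R} g^i(f) ≠ q^{p^j a}` for `f ∈ F_{n+R}`, `d + j ≤ R`, `p ∤ a`, `q` of depth `d` (odd `p`).** Here `κ` is the
cyclotomic `ℤ_p`-extension, `v ∋ p`, `g ∈ Γ_{ℚ_v}` with `κ(res g) = p^n u_g` (a topological generator of `H_n` modulo `H_∞`),
`e : ℚ_v ≃ ℚ_p` a ring isomorphism and `q ∈ ℚ_v` with `e q = p^k u`, `‖1 − u^{p−1}‖ = p^{−d}`. With `g₀`, `κ(res g₀) = 1`,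
the elements `g₀^i g^{i'}` (`i < p^n`, `i' < p^R`) represent `Γ/H_{n+R}`, so `N_{F_{n+R}/ℚ_v}(f) = ∏_i g₀^i(∏_{i'} g^{i'} f)`;
if the inner product were `q^{p^j a} ∈ ℚ_v` the norm would be `q^{p^{n+j} a}`, contradicting `norm_ne_pow_of_depth_odd` at
level `n + R ≥ d + (n + j)`. The odd-`p` form of GEN 13's `prod_smul_ne_pow_of_depth`.
[cite: NeukirchANT1999, Ch. V §1 Thm. (1.1)] [cite: GreenbergLNM1716, §3, between Prop. 3.6 and Prop. 3.7 (PDF pp. 92–93)] -/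
theorem prod_smul_ne_pow_of_depth_odd (hp2 : p ≠ 2) (hκ : κ.IsCyclotomic) (v : HeightOneSpectrum (𝓞 ℚ))
    (hv : ((p : ℕ) : 𝓞 ℚ) ∈ v.asIdeal) (e : v.adicCompletion ℚ ≃+* ℚ_[p]) {q : v.adicCompletion ℚ} {k : ℕ}
    {u : ℤ_[p]ˣ} (hq : e q = (p : ℚ_[p]) ^ k * ((u : ℤ_[p]) : ℚ_[p])) {d : ℕ}
    (hd : ‖1 - ((u : ℤ_[p]) : ℚ_[p]) ^ (p - 1)‖ = (p : ℝ) ^ (-(d : ℤ)))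
    (n : ℕ) {g : absoluteGaloisGroup (v.adicCompletion ℚ)} {ug : ℤ_[p]ˣ}
    (hug : ((κ (resGal (K := ℚ) (v.adicCompletion ℚ) g)).toAdd : ℤ_[p]) = (p : ℤ_[p]) ^ n * (ug : ℤ_[p]))
    {a : ℕ} (ha : ¬ p ∣ a) {j R : ℕ} (hR : d + j ≤ R) {f : AlgebraicClosure (v.adicCompletion ℚ)}
    (hf : ∀ h ∈ localSubgroup (κ.layerSubgroup (n + R)) (v.adicCompletion ℚ), h • f = f) :
    (∏ i ∈ Finset.range (p ^ R), (g ^ i) • f) ≠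
      algebraMap (v.adicCompletion ℚ) (AlgebraicClosure (v.adicCompletion ℚ)) (q ^ (p ^ j * a)) := by
  intro hprod
  -- a local element `g₀` with `κ(res g₀) = 1`, and the representatives `g₀^i g^{i'}` of `Γ/H_{n+R}`
  obtain ⟨g₀, hg₀'⟩ := MultTowerNS2.surjective_kappa_comp_resGal hκ v hv (Multiplicative.ofAdd (1 : ℤ_[p]))
  have hg₀ : ((κ (resGal (K := ℚ) (v.adicCompletion ℚ) g₀)).toAdd : ℤ_[p]) =
      (p : ℤ_[p]) ^ 0 * ((1 : ℤ_[p]ˣ) : ℤ_[p]) := by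
    have h := congrArg Multiplicative.toAdd hg₀'
    rw [toAdd_ofAdd] at h
    rw [pow_zero, Units.val_one, one_mul]
    exact h
  have hcov : ∀ σ : absoluteGaloisGroup (v.adicCompletion ℚ), ∃ ji : Fin (p ^ n) × Fin (p ^ R),
      σ⁻¹ * (g₀ ^ (ji.1 : ℕ) * g ^ (ji.2 : ℕ)) ∈ localSubgroup (κ.layerSubgroup (n + R)) (v.adicCompletion ℚ) := by
    intro σ
    have hσ0 : σ ∈ localSubgroup (κ.layerSubgroup 0) (v.adicCompletion ℚ) := by
      rw [mem_localSubgroup_iff, ZpExtension.mem_layerSubgroup, pow_zero]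
      exact one_dvd _
    obtain ⟨i, hi, hiσ⟩ := GoodOrdTower.exists_pow_inv_mul_mem_localSubgroup_layerSubgroup (κ := κ) v 0 n hg₀ hσ0
    rw [Nat.zero_add] at hiσ
    obtain ⟨i', hi', hi'σ⟩ := GoodOrdTower.exists_pow_inv_mul_mem_localSubgroup_layerSubgroup (κ := κ) v n R hug hiσ
    refine ⟨(⟨i, hi⟩, ⟨i', hi'⟩), ?_⟩
    have h := Subgroup.inv_mem _ hi'σ
    have heq : ((g ^ i')⁻¹ * ((g₀ ^ i)⁻¹ * σ))⁻¹ = σ⁻¹ * (g₀ ^ i * g ^ i') := by group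
    rw [heq] at h
    exact h
  -- the fixed field `F_{n+R}` and `f` as its element
  haveI := MultTowerNS2.finiteDimensional_fixedField_localSubgroup_layerSubgroup (κ := κ) v (n + R)
  have hopen := MultTowerNS2.isOpen_localSubgroup (κ.layerSubgroup (n + R)) (κ.isOpen_layerSubgroup (n + R))
    (v.adicCompletion ℚ)
  haveI := isGalois_fixedField_of_isOpen_of_normal v (localSubgroup (κ.layerSubgroup (n + R)) (v.adicCompletion ℚ))
    hopen (by rw [localSubgroup_eq_comap]; exact Subgroup.Normal.comap inferInstance _)
  have hrank := MultTowerNS2.finrank_fixedField_localSubgroup_layerSubgroup hκ v hv (n + R)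
  let f' : IntermediateField.fixedField (localSubgroup (κ.layerSubgroup (n + R)) (v.adicCompletion ℚ)) :=
    ⟨f, (IntermediateField.mem_fixedField_iff _ _).mpr fun h hh ↦ hf h hh⟩
  have hne := norm_ne_pow_of_depth_odd hp2 hκ v hv e hq hd ha (j := n + j) (m := n + R) (by omega) f'
  have hcard : Fintype.card (Fin (p ^ n) × Fin (p ^ R)) = Module.finrank (v.adicCompletion ℚ)
      (IntermediateField.fixedField (localSubgroup (κ.layerSubgroup (n + R)) (v.adicCompletion ℚ))) := by
    rw [hrank, Fintype.card_prod, Fintype.card_fin, Fintype.card_fin, pow_add]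
  -- (`CharZero ℚ_v` only now: it changes the preferred `Algebra ℚ ℚ_v` instance, see BRICK 14)
  haveI : CharZero (v.adicCompletion ℚ) :=
    charZero_of_injective_algebraMap (algebraMap ℚ (v.adicCompletion ℚ)).injective
  have hfix := fixingSubgroup_fixedField_of_isOpen _ hopen
  have hH := fun σ ↦ SetLike.ext_iff.mp hfix σ
  have hnorm := MultTowerNS2.algebraMap_norm_eq_prod_smul v _ hH
    (fun ji : Fin (p ^ n) × Fin (p ^ R) ↦ g₀ ^ (ji.1 : ℕ) * g ^ (ji.2 : ℕ)) hcov hcard f'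
  -- `∏_{i,i'} g₀^i g^{i'} f = ∏_i g₀^i (q^N) = q^{N p^n}`
  have hinner : ∀ i : Fin (p ^ n), (∏ i' : Fin (p ^ R), (g₀ ^ (i : ℕ) * g ^ (i' : ℕ)) •
      (f' : AlgebraicClosure (v.adicCompletion ℚ))) =
        algebraMap (v.adicCompletion ℚ) (AlgebraicClosure (v.adicCompletion ℚ)) (q ^ (p ^ j * a)) := by
    intro i
    have h1 : (∏ i' : Fin (p ^ R), (g₀ ^ (i : ℕ) * g ^ (i' : ℕ)) • (f' : AlgebraicClosure (v.adicCompletion ℚ))) =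
        g₀ ^ (i : ℕ) • ∏ i' ∈ Finset.range (p ^ R), (g ^ i') • f := by
      rw [← Fin.prod_univ_eq_prod_range (fun i' ↦ (g ^ i') • f) (p ^ R), Finset.smul_prod']
      refine Finset.prod_congr rfl fun i' _ ↦ ?_
      rw [mul_smul]
    rw [h1, hprod]
    exact AlgEquiv.commutes (absoluteGaloisGroup.toAlgEquiv _ (g₀ ^ (i : ℕ))) _
  rw [Fintype.prod_prod_type, Finset.prod_congr rfl (fun i _ ↦ hinner i), Finset.prod_const, Finset.card_univ,
    Fintype.card_fin, ← map_pow, ← pow_mul] at hnorm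
  have hNe : Algebra.norm (v.adicCompletion ℚ) f' = q ^ (p ^ j * a * p ^ n) :=
    (algebraMap (v.adicCompletion ℚ) (AlgebraicClosure (v.adicCompletion ℚ))).injective hnorm
  have hexp : p ^ j * a * p ^ n = p ^ (n + j) * a := by rw [pow_add]; ring
  rw [hexp] at hNe
  exact hne hNe

end Summit.BirchSwinnertonDyer.BirchSwinnertonDyer.Theorems.MultTowerSplitExact

end
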